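import Mathlib
import Summits.ValiantsHypothesis.ValiantsHypothesis.Theorems.LacunarySymmetroidMatrixDescartesGramDualSpectral
import Summits.ValiantsHypothesis.ValiantsHypothesis.Theorems.LacunarySymmetroidMatrixDescartesGramDualPencil
import Summits.ValiantsHypothesis.ValiantsHypothesis.Theorems.LacunarySymmetroidMatrixDescartesGramDualInertia
import Summits.ValiantsHypothesis.ValiantsHypothesis.Theorems.LacunarySymmetroidMatrixDescartesStubDescartesCeiling

/-!
# `MatrixDescartes` (stmt-ValiantsHypothesis-18050) — Gram duality, part 17: GRAM RANK IS THE SIZE — a pencil with a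
# non-degenerate letter has the positive zeros of a pencil WITH THE SAME EXPONENT VECTOR whose size is the rank of
# its Gram matrix; Descartes' ceiling at the effective format `(rank, K)`, at every size

HONEST FRAMING.  Cell `pub-symmetroid`, seat `val-sym-mdr-p2` (gen 20); helper file `--supports` the crux
`Theses.LacunarySymmetroid.MatrixDescartes` (OPEN), NO closure claim; companion of `…GramDualSpectral` (effective size
of a signed column word = rank of its Gram matrix) and `…GramDualPencil` (the crux's pencils are signed column words).
A STRUCTURE THEOREM with a counting corollary; nothing here bears on the crux in its window, `stub_twoSided`,
`DoorA26` / `DoorA34`, registers, or `VP ≠ VNP`.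

THE THEOREM (`exists_pencil_of_size_gramRank`).  Let `Σ_{l<K} X^{d_l} S_l` be a pencil of real symmetric `m × m`
letters with `det S_{l₀} ≠ 0`, let `U` be the matrix of the non-zero eigen-columns of the letters `l ≠ l₀` and
`𝔾 = Uᵀ S_{l₀}⁻¹ U` their GRAM MATRIX in the (indefinite) metric `S_{l₀}⁻¹`, `r = rank 𝔾`.  Then there is a pencil
`Σ_l X^{d_l} S'_l` of real symmetric `r × r` letters — THE SAME `K` AND THE SAME EXPONENT VECTOR `d`, `S'_{l₀}`
non-degenerate (indeed diagonal: the inverted non-zero eigenvalues of `𝔾`), `S'_l` for `l ≠ l₀` the letter `l`'s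
eigen-columns read through the eigenvectors of `𝔾` — with EXACTLY the same number of distinct positive zeros of the
determinant.  `r ≤ m` and `r ≤ Σ_{l≠l₀} rank S_l` (`rank_gram_le_size`, `rank_gram_le_sum_rank`); `r` can be much
smaller than both (columns in `S_{l₀}⁻¹`-isotropic directions orthogonal to the span are invisible; `𝔾 = 0` ⇒ `r = 0`).
PROOF: `…GramDualPencil` (signed column form) → `…GramDualSpectral` (effective size = Gram rank, a signed column word of
size `r` with the same signs and exponents) → regrouping the columns by letter (`base_add_signedPart_eq_pencil`: a signed
column word whose exponents factor through `d` IS a pencil with exponent vector `d`) → reindexing by `Fin r`.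

COROLLARY (`card_posRoots_pencil_le_choose_gramRank`, Descartes at the EFFECTIVE FORMAT): `Z₊ + 1 ≤ C(r + K − 1, r)` — the
tree's count-vector ceiling `stub_descartesCeiling` of the format `(r, K)`, valid at EVERY size `m`; uniform form
`card_posRoots_pencil_le_choose_of_gramRank_le` (`rank 𝔾 ≤ r` ⇒ `Z₊ + 1 ≤ C(r + K − 1, r)`).  Compared with the tree's
size-free ceilings — `lowRankCeiling` (`Z₊ + 1 ≤ ∏_{l≠l₀}(rank S_l + 1)`, any pivot) and the joint-rank ceiling
`commonDirection_jointRank_ceiling` (`Z₊ + 1 ≤ (K−1) + C(r_J + K − 1, r_J)`, `r_J` = dimension of the joint row space) —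
this one needs a NON-DEGENERATE symmetric pivot but counts with the GRAM rank `r ≤ r_J` (strictly smaller whenever the
joint range meets its own `S_{l₀}⁻¹`-orthogonal) and has no `K − 1` term.  The all-real-roots form and the crux
inequality on the sector «Gram rank `O(K)`, any size» are in the companion `…GramDualRankMDR`.

[folklore] (spectral theorem + Sylvester + stars and bars).  Axioms `propext`, `Classical.choice`, `Quot.sound`.
-/

-- layout Summits/ValiantsHypothesis/ValiantsHypothesis forces the duplicated namespace component
set_option linter.dupNamespace false

namespace Summit.ValiantsHypothesis.ValiantsHypothesis.Theorems.LacunarySymmetroidMatrixDescartes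

open Polynomial Matrix Finset
open scoped BigOperators

namespace GramDual

/-- the signed column part `U · diag(σⱼ X^{δⱼ}) · Uᵀ` (file-local notation, as in `…GramDualSigned`) -/
local notation3 (prettyPrint := false) "𝕊[" U ", " σ ", " δ "]" =>
  ((U : Matrix _ _ ℝ).map Polynomial.C
      * Matrix.diagonal (fun j => Polynomial.C ((σ : _ → ℝ) j) * (Polynomial.X : Polynomial ℝ) ^ (δ j : ℕ))
      * ((U : Matrix _ _ ℝ).map Polynomial.C)ᵀ)

/-- the signed primal word `X^e • B + U · diag(σⱼ X^{δⱼ}) · Uᵀ` (file-local notation, as in `…GramDualSigned`) -/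
local notation3 (prettyPrint := false) "𝔽ₛ[" e ", " B ", " U ", " σ ", " δ "]" =>
  (((Polynomial.X : Polynomial ℝ) ^ (e : ℕ)) • (B : Matrix _ _ ℝ).map Polynomial.C + 𝕊[U, σ, δ])

/-! ## §1  A signed column word whose exponents factor through `d` is a pencil with exponent vector `d` -/

section Regroup

variable {K : ℕ} {τ ρ : Type} [Fintype ρ] [DecidableEq ρ]

/-- Entry formula of the signed column part: `(U diag(σX^δ) Uᵀ)_{ab} = Σ_t X^{δ_t} C(U_{at} σ_t U_{bt})`. [folklore] -/
theorem signedPart_apply (A : Matrix τ ρ ℝ) (σ : ρ → ℝ) (δ : ρ → ℕ) (a b : τ) :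
    (𝕊[A, σ, δ]) a b = ∑ t, (Polynomial.X : Polynomial ℝ) ^ δ t * Polynomial.C (A a t * σ t * A b t) := by
  rw [Matrix.mul_apply]
  refine Finset.sum_congr rfl fun t _ => ?_
  rw [Matrix.mul_diagonal, Matrix.transpose_apply, Matrix.map_apply, Matrix.map_apply, map_mul, map_mul]
  ring

/-- Entry formula of the letter-`l` part `A · diag(σ·1_{π = l}) · Aᵀ`. [folklore] -/
theorem letterOf_apply (A : Matrix τ ρ ℝ) (σ : ρ → ℝ) (π : ρ → Fin K) (l : Fin K) (a b : τ) :
    (A * Matrix.diagonal (fun t => if π t = l then σ t else 0) * Aᵀ) a b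
      = ∑ t, if π t = l then A a t * σ t * A b t else 0 := by
  rw [Matrix.mul_apply]
  refine Finset.sum_congr rfl fun t _ => ?_
  rw [Matrix.mul_diagonal, Matrix.transpose_apply]
  split_ifs
  · rfl
  · rw [mul_zero, zero_mul]

/-- **Regrouping columns by letter.**  If the column exponents factor as `δ = d ∘ π` through a letter map
`π : ρ → Fin K` avoiding `l₀`, then
`X^{d_{l₀}} B + U diag(σX^δ) Uᵀ = Σ_l X^{d_l} S'_l` with `S'_{l₀} = B` and `S'_l = U diag(σ·1_{π=l}) Uᵀ` (`l ≠ l₀`) —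
written uniformly as `S'_l = [l = l₀]·B + U diag(σ·1_{π=l}) Uᵀ`. [folklore] -/
theorem base_add_signedPart_eq_pencil (B : Matrix τ τ ℝ) (A : Matrix τ ρ ℝ) (σ : ρ → ℝ) (π : ρ → Fin K)
    (d : Fin K → ℕ) (l₀ : Fin K) :
    𝔽ₛ[d l₀, B, A, σ, (fun t => d (π t))]
      = ∑ l, ((Polynomial.X : Polynomial ℝ) ^ d l) •
          ((if l = l₀ then B else 0) + A * Matrix.diagonal (fun t => if π t = l then σ t else 0) * Aᵀ).map
            Polynomial.C := by
  have hsplit : (∑ l, ((Polynomial.X : Polynomial ℝ) ^ d l) •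
        ((if l = l₀ then B else 0) + A * Matrix.diagonal (fun t => if π t = l then σ t else 0) * Aᵀ).map
          Polynomial.C)
      = (∑ l, ((Polynomial.X : Polynomial ℝ) ^ d l) • (if l = l₀ then B else 0).map Polynomial.C)
        + ∑ l, ((Polynomial.X : Polynomial ℝ) ^ d l) •
            (A * Matrix.diagonal (fun t => if π t = l then σ t else 0) * Aᵀ).map Polynomial.C := by
    rw [← Finset.sum_add_distrib]
    refine Finset.sum_congr rfl fun l _ => ?_
    rw [Matrix.map_add _ (map_add Polynomial.C), smul_add]
  have hbase : (∑ l, ((Polynomial.X : Polynomial ℝ) ^ d l) • (if l = l₀ then B else 0).map Polynomial.C)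
      = ((Polynomial.X : Polynomial ℝ) ^ d l₀) • B.map Polynomial.C := by
    rw [Finset.sum_eq_single l₀]
    · rw [if_pos rfl]
    · intro l _ hl
      rw [if_neg hl, Matrix.map_zero _ (map_zero _), smul_zero]
    · intro h
      exact absurd (Finset.mem_univ l₀) h
  rw [hsplit, hbase]
  congr 1
  refine Matrix.ext fun a b => ?_
  rw [signedPart_apply, Matrix.sum_apply]
  simp only [Matrix.smul_apply, Matrix.map_apply, letterOf_apply, smul_eq_mul]
  -- swap the sums: for each column `t` only the letter `l = π t` contributes
  simp only [map_sum, Finset.mul_sum]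
  rw [Finset.sum_comm]
  refine Finset.sum_congr rfl fun t _ => ?_
  rw [Finset.sum_eq_single (π t)]
  · rw [if_pos rfl]
  · intro l _ hl
    rw [if_neg (Ne.symm hl), map_zero, mul_zero]
  · intro h
    exact absurd (Finset.mem_univ _) h

/-- The regrouped letters are symmetric when the base is. [folklore] -/
theorem letters_isSymm {B : Matrix τ τ ℝ} (hB : B.IsSymm) (A : Matrix τ ρ ℝ) (σ : ρ → ℝ) (π : ρ → Fin K)
    (l₀ l : Fin K) :
    ((if l = l₀ then B else 0) + A * Matrix.diagonal (fun t => if π t = l then σ t else 0) * Aᵀ).IsSymm := by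
  have h1 : (if l = l₀ then B else (0 : Matrix τ τ ℝ)).IsSymm := by
    split_ifs
    · exact hB
    · exact Matrix.isSymm_zero
  have h2 : (A * Matrix.diagonal (fun t => if π t = l then σ t else 0) * Aᵀ).IsSymm := by
    unfold Matrix.IsSymm
    rw [Matrix.transpose_mul, Matrix.transpose_mul, Matrix.transpose_transpose, Matrix.diagonal_transpose,
      Matrix.mul_assoc]
  exact h1.add h2

/-- At the base index the regrouped letter is the base (the letter map avoids `l₀`). [folklore] -/
theorem letters_base (B : Matrix τ τ ℝ) (A : Matrix τ ρ ℝ) (σ : ρ → ℝ) (π : ρ → Fin K) (l₀ : Fin K)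
    (hπ : ∀ t, π t ≠ l₀) :
    ((if l₀ = l₀ then B else 0) + A * Matrix.diagonal (fun t => if π t = l₀ then σ t else 0) * Aᵀ) = B := by
  have hdiag0 : Matrix.diagonal (fun t => if π t = l₀ then σ t else 0) = 0 := by
    rw [← Matrix.diagonal_zero]
    congr 1
    funext t
    exact if_neg (hπ t)
  rw [if_pos rfl, hdiag0, Matrix.mul_zero, Matrix.zero_mul, add_zero]

/-- Reindexing a pencil letter by letter reindexes the pencil. [folklore] -/
theorem pencil_reindex {n : ℕ} (e : τ ≃ Fin n) (d : Fin K → ℕ) (S₁ : Fin K → Matrix τ τ ℝ) :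
    (∑ l, ((Polynomial.X : Polynomial ℝ) ^ d l) • (Matrix.reindex e e (S₁ l)).map Polynomial.C)
      = Matrix.reindex e e (∑ l, ((Polynomial.X : Polynomial ℝ) ^ d l) • (S₁ l).map Polynomial.C) := by
  refine Matrix.ext fun i j => ?_
  simp only [Matrix.reindex_apply, Matrix.submatrix_apply, Matrix.sum_apply, Matrix.smul_apply,
    Matrix.map_apply]

end Regroup

/-! ## §2  Gram rank is the size -/

section Rank

variable {K m : ℕ} (d : Fin K → ℕ) (S : Fin K → Matrix (Fin m) (Fin m) ℝ) (hS : ∀ l, (S l).IsHermitian) (l₀ : Fin K)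

/-- the column type: non-zero eigen-columns `(l, i)` of the letters `l ≠ l₀` (file-local notation) -/
local notation3 (prettyPrint := false) "𝕋" =>
  {li : Fin K × Fin m // li.1 ≠ l₀ ∧ (hS li.1).eigenvalues li.2 ≠ 0}

/-- the eigen-column matrix `U` (file-local notation) -/
local notation3 (prettyPrint := false) "𝕌" =>
  (Matrix.of fun (a : Fin m) (t : 𝕋) => ((hS t.1.1).eigenvectorUnitary : Matrix (Fin m) (Fin m) ℝ) a t.1.2)

/-- the signs = eigenvalues of the eigen-columns (file-local notation) -/
local notation3 (prettyPrint := false) "σσ" => (fun t : 𝕋 => (hS t.1.1).eigenvalues t.1.2)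

/-- the GRAM MATRIX `𝔾 = Uᵀ S_{l₀}⁻¹ U` of the eigen-columns in the metric `S_{l₀}⁻¹` (file-local notation) -/
local notation3 (prettyPrint := false) "𝔾" => ((𝕌)ᵀ * (S l₀)⁻¹ * (𝕌))

/-- Over `ℝ` a hermitian matrix is symmetric. [folklore] -/
theorem isSymm_of_isHermitian_real {A : Matrix (Fin m) (Fin m) ℝ} (hA : A.IsHermitian) : A.IsSymm := by
  have h := hA
  unfold Matrix.IsHermitian at h
  rw [Matrix.conjTranspose_eq_transpose_of_trivial] at h
  exact h

/-- The Gram matrix of the eigen-columns is symmetric (hermitian). [folklore] -/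
theorem isHermitian_pencilGram : (𝔾).IsHermitian :=
  isHermitian_gram (isSymm_of_isHermitian_real (hS l₀)) _

/-- `rank 𝔾 ≤ m`. [folklore] -/
theorem rank_gram_le_size : (𝔾).rank ≤ m := by
  have h := rank_gram_le (S l₀) (𝕌)
  rwa [Fintype.card_fin] at h

/-- `rank 𝔾 ≤ Σ_{l ≠ l₀} rank S_l` (the number of columns). [folklore] -/
theorem rank_gram_le_sum_rank : (𝔾).rank ≤ ∑ l ∈ Finset.univ.erase l₀, (S l).rank := by
  classical
  rw [← card_cols_eq_sum_rank S hS l₀]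
  exact Matrix.rank_le_card_width _

/-- **GRAM RANK IS THE SIZE.**  Real symmetric letters, `det S_{l₀} ≠ 0`, `𝔾` the `S_{l₀}⁻¹`-Gram matrix of the non-zero
eigen-columns of the other letters, `r = rank 𝔾`: there is a pencil of real symmetric `r × r` letters with THE SAME
exponent vector `d`, `S'_{l₀}` non-degenerate, having exactly as many distinct positive zeros of its determinant as
`Σ_l X^{d_l} S_l`. [folklore] -/
theorem exists_pencil_of_size_gramRank (hS₀ : IsUnit (S l₀).det) :
    ∃ S' : Fin K → Matrix (Fin (𝔾).rank) (Fin (𝔾).rank) ℝ,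
      (∀ l, (S' l).IsSymm) ∧ IsUnit (S' l₀).det ∧
      ((Matrix.det (∑ l, ((Polynomial.X : Polynomial ℝ) ^ d l) • (S l).map Polynomial.C)).roots.toFinset.filter
          (fun t => 0 < t)).card
        = ((Matrix.det (∑ l, ((Polynomial.X : Polynomial ℝ) ^ d l) • (S' l).map Polynomial.C)).roots.toFinset.filter
          (fun t => 0 < t)).card := by
  classical
  have hC : (𝔾).IsHermitian := isHermitian_pencilGram S hS l₀
  -- the reduced base `Dτ⁻¹`, the reduced columns `A` (eigenvectors of `𝔾` with non-zero eigenvalue)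
  set Dτ : Matrix {i : 𝕋 // hC.eigenvalues i ≠ 0} {i : 𝕋 // hC.eigenvalues i ≠ 0} ℝ :=
    Matrix.diagonal (fun i : {i : 𝕋 // hC.eigenvalues i ≠ 0} => hC.eigenvalues i.1) with hDτ
  set A : Matrix {i : 𝕋 // hC.eigenvalues i ≠ 0} 𝕋 ℝ :=
    Matrix.of fun (i : {i : 𝕋 // hC.eigenvalues i ≠ 0}) (t : 𝕋) => (hC.eigenvectorUnitary : Matrix 𝕋 𝕋 ℝ) t i.1
    with hA
  -- steps 1–2: signed column form and effective size
  have h12 : ((Matrix.det (∑ l, ((Polynomial.X : Polynomial ℝ) ^ d l) • (S l).map Polynomial.C)).roots.toFinset.filter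
        (fun t => 0 < t)).card
      = ((Matrix.det (𝔽ₛ[d l₀, Dτ⁻¹, A, σσ, (fun t : 𝕋 => d t.1.1)])).roots.toFinset.filter (fun t => 0 < t)).card := by
    rw [pencil_eq_base_add_signedPart d S hS l₀]
    exact card_posRoots_base_eq_spectral (S l₀) hS₀ (𝕌) (σσ) (fun t => t.2.2) (d l₀) (fun t : 𝕋 => d t.1.1) hC
  -- step 3: regroup the reduced columns by letter
  have h3 : 𝔽ₛ[d l₀, Dτ⁻¹, A, σσ, (fun t : 𝕋 => d t.1.1)]
      = ∑ l, ((Polynomial.X : Polynomial ℝ) ^ d l) •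
          ((if l = l₀ then Dτ⁻¹ else 0)
            + A * Matrix.diagonal (fun t : 𝕋 => if t.1.1 = l then (σσ) t else 0) * Aᵀ).map Polynomial.C :=
    base_add_signedPart_eq_pencil Dτ⁻¹ A (σσ) (fun t : 𝕋 => t.1.1) d l₀
  -- step 4: reindex by `Fin r`, `r = card {μ ≠ 0} = rank 𝔾`
  have hcard : Fintype.card {i : 𝕋 // hC.eigenvalues i ≠ 0} = (𝔾).rank := card_effective_eq_rank hC
  refine ⟨fun l => Matrix.reindex (Fintype.equivFinOfCardEq hcard) (Fintype.equivFinOfCardEq hcard)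
      ((if l = l₀ then Dτ⁻¹ else 0)
        + A * Matrix.diagonal (fun t : 𝕋 => if t.1.1 = l then (σσ) t else 0) * Aᵀ),
    fun l => ?_, ?_, ?_⟩
  · -- symmetry
    exact (letters_isSymm (isSymm_inv (Matrix.isSymm_diagonal _)) A (σσ) (fun t : 𝕋 => t.1.1) l₀ l).submatrix _
  · -- non-degeneracy of the reduced base
    rw [Matrix.det_reindex_self, letters_base Dτ⁻¹ A (σσ) (fun t : 𝕋 => t.1.1) l₀ (fun t => t.2.1),
      Matrix.isUnit_nonsing_inv_det_iff]
    exact isUnit_det_spectralDiag hC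
  · -- same positive zeros
    rw [h12, h3, pencil_reindex, Matrix.det_reindex_self]

/-! ## §3  Descartes' ceiling at the effective format `(rank 𝔾, K)`, at every size -/

/-- **DESCARTES AT THE EFFECTIVE FORMAT.**  `det S_{l₀} ≠ 0`, `r = rank 𝔾` ⇒ `Z₊ + 1 ≤ C(r + K − 1, r)` for
`Z₊` = number of distinct positive zeros of `det(Σ_l X^{d_l} S_l)` — independently of the size `m`. [folklore] -/
theorem card_posRoots_pencil_le_choose_gramRank (hS₀ : IsUnit (S l₀).det) :
    ((Matrix.det (∑ l, ((Polynomial.X : Polynomial ℝ) ^ d l) • (S l).map Polynomial.C)).roots.toFinset.filter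
        (fun t => 0 < t)).card + 1 ≤ Nat.choose ((𝔾).rank + K - 1) (𝔾).rank := by
  obtain ⟨S', -, -, hZ⟩ := exists_pencil_of_size_gramRank d S hS l₀ hS₀
  rw [hZ]
  exact stub_descartesCeiling K _ (Fin.pos l₀) d S'

/-- Monotonicity of the count-vector number in the size: `r ≤ r'` ⇒ `C(r + K − 1, r) ≤ C(r' + K − 1, r')` (`K ≥ 1`).
[folklore] -/
theorem choose_format_mono {r r' K : ℕ} (hK : 0 < K) (h : r ≤ r') :
    Nat.choose (r + K - 1) r ≤ Nat.choose (r' + K - 1) r' := by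
  have e1 : Nat.choose (r + K - 1) r = Nat.choose (r + (K - 1)) (K - 1) := by
    rw [show r + K - 1 = r + (K - 1) by omega, Nat.choose_symm_add]
  have e2 : Nat.choose (r' + K - 1) r' = Nat.choose (r' + (K - 1)) (K - 1) := by
    rw [show r' + K - 1 = r' + (K - 1) by omega, Nat.choose_symm_add]
  rw [e1, e2]
  exact Nat.choose_le_choose (K - 1) (by omega)

/-- **Uniform form**: `rank 𝔾 ≤ r` ⇒ `Z₊ + 1 ≤ C(r + K − 1, r)`, at every size `m`. [folklore] -/
theorem card_posRoots_pencil_le_choose_of_gramRank_le (hS₀ : IsUnit (S l₀).det) (r : ℕ) (hr : (𝔾).rank ≤ r) :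
    ((Matrix.det (∑ l, ((Polynomial.X : Polynomial ℝ) ^ d l) • (S l).map Polynomial.C)).roots.toFinset.filter
        (fun t => 0 < t)).card + 1 ≤ Nat.choose (r + K - 1) r :=
  (card_posRoots_pencil_le_choose_gramRank d S hS l₀ hS₀).trans (choose_format_mono (Fin.pos l₀) hr)

/-- **Gram rank zero** (`𝔾 = 0`-rank, e.g. all eigen-columns `S_{l₀}⁻¹`-isotropic and pairwise orthogonal): no positive
zero, at every size and all exponents. [folklore] -/
theorem card_posRoots_pencil_eq_zero_of_gramRank_eq_zero (hS₀ : IsUnit (S l₀).det) (hr : (𝔾).rank = 0) :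
    ((Matrix.det (∑ l, ((Polynomial.X : Polynomial ℝ) ^ d l) • (S l).map Polynomial.C)).roots.toFinset.filter
        (fun t => 0 < t)).card = 0 := by
  have h := card_posRoots_pencil_le_choose_of_gramRank_le d S hS l₀ hS₀ 0 hr.le
  rw [Nat.choose_zero_right] at h
  omega

/-- **Gram rank one**: `Z₊ ≤ K − 1` at every size (a `1 × 1` pencil with `K` letters is a real `K`-nomial).
[folklore] -/
theorem card_posRoots_pencil_le_of_gramRank_le_one (hS₀ : IsUnit (S l₀).det) (hr : (𝔾).rank ≤ 1) :
    ((Matrix.det (∑ l, ((Polynomial.X : Polynomial ℝ) ^ d l) • (S l).map Polynomial.C)).roots.toFinset.filter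
        (fun t => 0 < t)).card ≤ K - 1 := by
  have h := card_posRoots_pencil_le_choose_of_gramRank_le d S hS l₀ hS₀ 1 hr
  have hK : 1 + K - 1 = K := by omega
  rw [hK, Nat.choose_one_right] at h
  omega

end Rank

end GramDual

end Summit.ValiantsHypothesis.ValiantsHypothesis.Theorems.LacunarySymmetroidMatrixDescartes
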